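import Literature.Analysis.FluidPDE.ElgindiVeryWeakUniqueness
import Literature.Analysis.FluidPDE.ElgindiTransposeMonomialModes
import Literature.Analysis.FluidPDE.ElgindiOperatorLocality
import Literature.Analysis.FluidPDE.ElgindiEllipticWeakEquation
import HarnessLib

/-!
# Uniqueness of square-integrable solutions of `L(Ψ) = F` tested against the profiles `cos²θ·χ`
([Elgindi2021] §7.1, Proposition 7.1: "the unique `L²` solution")

Topic `Literature/Analysis/FluidPDE`. Proof file (everything proved, no definitions, no named
facts) on the proof path of the named fact
`Literature.Analysis.FluidPDE.Elgindi.ElgindiGhoulMasmoudi2021_stabilityCore`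
(`ElgindiStabilityDecomposition.lean`). T. M. Elgindi, Ann. of Math. 194 (2021) =
arXiv:1904.04795, §7.1 Proposition 7.1 (p. 19 of the held text).

`ae_eq_zero_of_classVeryWeak`: a measurable `D ∈ L²(strip)` with `∫∫ D·ᵗL(cos²θ·χ) = 0` for every
smooth `χ` compactly supported inside `R > 0` with `χ(R,0) = 0` vanishes a.e. (the test profiles
`cos²θ·χ = cos θ·(cos θχ)` belong to Elgindi's class and keep `ᵗL` bounded at `θ = π/2`). Proof:
take `χ = a(R) sinʲθ·η(θ)` (`η` the angular plateau cutoff, `j` odd) and use the triangular action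
of `ᵗL` on `a(R)cos²θ sinʲθ` (`transposeOp_radial_mul_monomial`) to feed
`ae_eq_zero_of_veryWeak_modes`. Consequently two square-integrable very weak solutions of
`L(Ψ) = F` in this sense coincide (`ae_eq_of_classVeryWeak`).
-/

noncomputable section

open MeasureTheory Set Real Filter Function
open _root_.Topology
open scoped ContDiff

namespace Literature.Analysis.FluidPDE

namespace Elgindi

/-- The angular plateau cutoff is `1` on `(π/4 − 2, π/4 + 2) ⊇ [0, π/2]`. [folklore] -/
theorem thetaCutoff_eq_one_of_mem {θ : ℝ} (hθ : θ ∈ Ioo (π / 4 - 2) (π / 4 + 2)) : thetaCutoff θ = 1 := by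
  apply ContDiffBump.one_of_mem_closedBall
  rw [Metric.mem_closedBall, Real.dist_eq, abs_le]
  constructor <;> linarith [hθ.1, hθ.2]

/-- The strip lies in the plateau slab. [folklore] -/
theorem strip_subset_slab : strip ⊆ (univ : Set ℝ) ×ˢ Ioo (π / 4 - 2) (π / 4 + 2) := by
  rintro ⟨R, θ⟩ ⟨-, hθ⟩
  have hθ' : θ ∈ Ioo 0 (π / 2) := hθ
  have h4 : π < 4 := Real.pi_lt_four
  refine ⟨mem_univ _, ?_, ?_⟩
  · show π / 4 - 2 < θ
    linarith [hθ'.1]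
  · show θ < π / 4 + 2
    linarith [hθ'.2, Real.pi_pos]

/-- **The separated test profiles** `χ(R,θ) = a(R) sinʲθ η(θ)`: smooth, compactly supported inside
`R > 0`, vanishing on `θ = 0` (`j ≥ 1`). [folklore] -/
theorem sepProfile_test {a : ℝ → ℝ} (ha : ContDiff ℝ ∞ a) (has : HasCompactSupport a) (haS : tsupport a ⊆ Ioi 0)
    {j : ℕ} (hj : 1 ≤ j) :
    (∀ n : ℕ, ContDiff ℝ n (uncurry fun R θ => a R * (Real.sin θ ^ j * thetaCutoff θ))) ∧
    HasCompactSupport (uncurry fun R θ => a R * (Real.sin θ ^ j * thetaCutoff θ)) ∧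
    (∀ p ∈ tsupport (uncurry fun R θ => a R * (Real.sin θ ^ j * thetaCutoff θ)), 0 < p.1) ∧
    (∀ R, (fun R θ => a R * (Real.sin θ ^ j * thetaCutoff θ)) R 0 = 0) := by
  have e : uncurry (fun R θ => a R * (Real.sin θ ^ j * thetaCutoff θ)) = fun p : ℝ × ℝ => a p.1 * (Real.sin p.2 ^ j * thetaCutoff p.2) := by
    funext p; rfl
  have hg : ContDiff ℝ ∞ fun θ => Real.sin θ ^ j * thetaCutoff θ := (Real.contDiff_sin.pow j).mul contDiff_thetaCutoff
  have hgs : HasCompactSupport fun θ => Real.sin θ ^ j * thetaCutoff θ := hasCompactSupport_thetaCutoff.mul_left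
  refine ⟨fun n => ?_, ?_, fun p hp => ?_, fun R => ?_⟩
  · rw [e]
    exact ((ha.of_le (by exact_mod_cast (le_top : (n : ℕ∞) ≤ ⊤))).comp contDiff_fst).mul
      ((hg.of_le (by exact_mod_cast (le_top : (n : ℕ∞) ≤ ⊤))).comp contDiff_snd)
  · rw [e]
    refine HasCompactSupport.of_support_subset_isCompact (has.isCompact.prod hgs.isCompact) fun p hp => ?_
    simp only [mem_support, ne_eq, mul_eq_zero, not_or] at hp
    exact ⟨subset_closure hp.1, subset_closure (by simpa [mul_eq_zero, not_or] using hp.2)⟩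
  · rw [e] at hp
    have h : tsupport (fun p : ℝ × ℝ => a p.1 * (Real.sin p.2 ^ j * thetaCutoff p.2)) ⊆ (tsupport a) ×ˢ (univ : Set ℝ) := by
      refine closure_minimal (fun q hq => ?_) ((isClosed_tsupport a).prod isClosed_univ)
      simp only [mem_support, ne_eq] at hq
      exact ⟨subset_closure fun h0 => hq (by rw [show a q.1 = 0 from h0, zero_mul]), mem_univ _⟩
    exact haS (h hp).1
  · show a R * (Real.sin 0 ^ j * thetaCutoff 0) = 0
    rw [Real.sin_zero, zero_pow (by omega), zero_mul, mul_zero]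

set_option maxHeartbeats 800000 in
/-- **Uniqueness tested against `cos²θ·χ`**: a measurable `D ∈ L²(strip)` with
`∫∫ D·ᵗL(cos²θ·χ) = 0` for all smooth `χ` compactly supported inside `R > 0` with `χ(R,0) = 0`
vanishes a.e. on the strip (`α > 0`). [cite: Elgindi2021, §7.1 Proposition 7.1 "the unique L² solution" (p. 19 of arXiv:1904.04795)] -/
theorem ae_eq_zero_of_classVeryWeak {α : ℝ} (hα : 0 < α) {D : ℝ × ℝ → ℝ} (hDm : StronglyMeasurable D)
    (hD2 : IntegrableOn (fun p => D p ^ 2) strip)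
    (Hc : ∀ χ : ℝ → ℝ → ℝ, (∀ n : ℕ, ContDiff ℝ n (uncurry χ)) → HasCompactSupport (uncurry χ) →
      (∀ p ∈ tsupport (uncurry χ), 0 < p.1) → (∀ R, χ R 0 = 0) →
      ∫ p in strip, D p * transposeOp α (fun R θ => Real.cos θ ^ 2 * χ R θ) p = 0) :
    D =ᵐ[volume.restrict strip] 0 := by
  refine ae_eq_zero_of_veryWeak_modes hDm hD2 2 (β := 5 * α - 3 * α ^ 2) (σ := 5 * α - α ^ 2 - 6) hα (by norm_num)
    (fun j hj a ha has haS => ?_)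
  have hj1 : 1 ≤ j := by obtain ⟨k, rfl⟩ := hj; omega
  obtain ⟨hχn, hχs, hχpos, hχ0⟩ := sepProfile_test ha has haS hj1
  have key := Hc _ hχn hχs hχpos hχ0
  refine Eq.trans (setIntegral_congr_fun measurableSet_strip fun p hp => ?_) key
  -- on the strip the profile is `a(R) cos²θ sinʲθ`, and `ᵗL` is local
  have hW : IsOpen ((univ : Set ℝ) ×ˢ Ioo (π / 4 - 2) (π / 4 + 2)) := isOpen_univ.prod isOpen_Ioo
  have hagree : ∀ q ∈ (univ : Set ℝ) ×ˢ Ioo (π / 4 - 2) (π / 4 + 2),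
      (fun R θ => a R * (Real.cos θ ^ 2 * Real.sin θ ^ j)) q.1 q.2 = (fun R θ => Real.cos θ ^ 2 * (a R * (Real.sin θ ^ j * thetaCutoff θ))) q.1 q.2 := by
    intro q hq
    show a q.1 * (Real.cos q.2 ^ 2 * Real.sin q.2 ^ j) = Real.cos q.2 ^ 2 * (a q.1 * (Real.sin q.2 ^ j * thetaCutoff q.2))
    rw [thetaCutoff_eq_one_of_mem hq.2]; ring
  rw [← eqOn_transposeOp α (f := fun R θ => a R * (Real.cos θ ^ 2 * Real.sin θ ^ j))
      (g := fun R θ => Real.cos θ ^ 2 * (a R * (Real.sin θ ^ j * thetaCutoff θ))) hW hagree (strip_subset_slab hp),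
    transposeOp_radial_mul_monomial α (contDiff_two_of_infty ha) hj1 hp]
  ring

/-- **Two square-integrable very weak solutions of `L(Ψ) = F` (tested against `cos²θ·χ`) coincide.**
[cite: Elgindi2021, §7.1 Proposition 7.1 "the unique L² solution" (p. 19 of arXiv:1904.04795)] -/
theorem ae_eq_of_classVeryWeak {α : ℝ} (hα : 0 < α) {u₁ u₂ F : ℝ × ℝ → ℝ}
    (h₁m : StronglyMeasurable u₁) (h₁2 : IntegrableOn (fun p => u₁ p ^ 2) strip)
    (h₂m : StronglyMeasurable u₂) (h₂2 : IntegrableOn (fun p => u₂ p ^ 2) strip)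
    (hint : ∀ χ : ℝ → ℝ → ℝ, (∀ n : ℕ, ContDiff ℝ n (uncurry χ)) → HasCompactSupport (uncurry χ) →
      (∀ p ∈ tsupport (uncurry χ), 0 < p.1) → (∀ R, χ R 0 = 0) →
      IntegrableOn (fun p => u₁ p * transposeOp α (fun R θ => Real.cos θ ^ 2 * χ R θ) p) strip ∧
      IntegrableOn (fun p => u₂ p * transposeOp α (fun R θ => Real.cos θ ^ 2 * χ R θ) p) strip)
    (H₁ : ∀ χ : ℝ → ℝ → ℝ, (∀ n : ℕ, ContDiff ℝ n (uncurry χ)) → HasCompactSupport (uncurry χ) →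
      (∀ p ∈ tsupport (uncurry χ), 0 < p.1) → (∀ R, χ R 0 = 0) →
      ∫ p in strip, u₁ p * transposeOp α (fun R θ => Real.cos θ ^ 2 * χ R θ) p = ∫ p in strip, F p * (Real.cos p.2 ^ 2 * χ p.1 p.2))
    (H₂ : ∀ χ : ℝ → ℝ → ℝ, (∀ n : ℕ, ContDiff ℝ n (uncurry χ)) → HasCompactSupport (uncurry χ) →
      (∀ p ∈ tsupport (uncurry χ), 0 < p.1) → (∀ R, χ R 0 = 0) →
      ∫ p in strip, u₂ p * transposeOp α (fun R θ => Real.cos θ ^ 2 * χ R θ) p = ∫ p in strip, F p * (Real.cos p.2 ^ 2 * χ p.1 p.2)) :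
    u₁ =ᵐ[volume.restrict strip] u₂ := by
  have hD := ae_eq_zero_of_classVeryWeak hα (h₁m.sub h₂m) (D := fun p => u₁ p - u₂ p)
    (by
      have := (h₁2.add h₂2).const_mul 2
      refine Integrable.mono' this ((h₁m.sub h₂m).aestronglyMeasurable.pow 2 |>.congr (ae_of_all _ fun p => rfl)) (ae_of_all _ fun p => ?_)
      rw [Real.norm_eq_abs, abs_of_nonneg (sq_nonneg _)]
      show (u₁ p - u₂ p) ^ 2 ≤ 2 * (u₁ p ^ 2 + u₂ p ^ 2)
      nlinarith [sq_nonneg (u₁ p + u₂ p)])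
    (fun χ hχn hχs hχpos hχ0 => by
      obtain ⟨i₁, i₂⟩ := hint χ hχn hχs hχpos hχ0
      have e : (fun p => (u₁ p - u₂ p) * transposeOp α (fun R θ => Real.cos θ ^ 2 * χ R θ) p) =
          fun p => u₁ p * transposeOp α (fun R θ => Real.cos θ ^ 2 * χ R θ) p - u₂ p * transposeOp α (fun R θ => Real.cos θ ^ 2 * χ R θ) p := by
        funext p; ring
      show ∫ p in strip, (u₁ p - u₂ p) * transposeOp α (fun R θ => Real.cos θ ^ 2 * χ R θ) p = 0
      rw [e, integral_sub i₁ i₂, H₁ χ hχn hχs hχpos hχ0, H₂ χ hχn hχs hχpos hχ0, sub_self])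
  filter_upwards [hD] with p hp
  have : u₁ p - u₂ p = 0 := hp
  linarith

end Elgindi

end Literature.Analysis.FluidPDE
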